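import Summits.CriticalPhenomena.PercolationContinuityZ3.Theses.PercShatteringRace
import Summits.CriticalPhenomena.PercolationContinuityZ3.Theses.PercFiniteBoxLRO
import Literature.Probability.Percolation.FiniteEnergy
import Literature.Probability.Percolation.CriticalContinuityProofs
import Literature.Probability.Percolation.SharpnessDCTProofs
import Literature.Probability.Percolation.BKFinitary
import Literature.Probability.Percolation.UniquenessZone

/-!
# Disproof of `NearLinearTwoClusterDecay` (stmt-CriticalPhenomena-5785) — findings

Standing adversary file (cdisprove) for the crux `U(1/6)` of route `PercShatteringRace`:
`P_{p_c}`(the configuration restricted to `Λ(m)`, `m = ⌈n^{7/6}⌉`, has two DISTINCT open clusters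
each meeting `Λ(n)` and `∂ⁱⁿΛ(m)`) `→ 0`.  Everything below is PROVED (rc 0, axioms
`propext/Classical.choice/Quot.sound`) except the single documented near-miss of § (e)
(`not_tendsto_bounded_multiplicative_aspect`, the print boundary, `sorry`); prose lives in
docstrings only.  A `def : Prop`-free, sorry-free landing version is attached to the item as
`Negative.lean` (namespace `…Cruxes.NearLinearTwoClusterDecay.Negative`).

## Verdict so far: RESISTS (no refutation); statement faithful, no junk
* `nearLinearTwoClusterDecay_iff` : crux `↔ AtExponent (7/6)` (`Iff.rfl`);
  `critBoxTwoArmsDecay_iff` : the sibling crux 0859 is `∀ α > 1, AtExponent α`.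
* Junk audit (docstring of `twoClusterEvt`): `p_c ∈ (0,1)` is PROVED in tree
  (`Grimmett1999_criticalProb_pos_lt_one_holds`), so no degenerate-parameter kill; non-lattice
  pairs in `ω` are a null set (`setBernoulli_ae_subset`) and every lemma here quotients them out;
  `m ≥ n + 1` for `n ≥ 2`; the event is a finite union of cylinders. Faithful to Cerf's
  two-arms(Λ(n), ℓ) (restricted-configuration distinctness).
* WHY IT RESISTS. In the orthodox picture (`θ(p_c)=0` + quasi-multiplicativity) the crux is TRUE:
  `twoClusterEvt ⊆ crossingEvt` (`twoClusterEvt_subset_crossingEvt`) and even `⊆ cross □ cross`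
  (BK, `bk_finitary` in tree), so `P ≤ P(Λ(n) ↔ ∂Λ(n^{7/6}))² ≈ n^{-0.16}`.  A refutation needs a
  `θ(p_c) > 0` world whose in-box clusters PROLIFERATE at aspect `n^{1/6}`; print has this only at
  bounded aspect (vdBvE arXiv:2009.13337 Prop. 2, `δ(d,M)` degrading in `M`) and for `d > 6`
  (`≍ L^{d-6}` spanning clusters, barrier `SpanningClustersAboveSix`).  No finite computation can
  decide a `p_c`-limit statement; Monte-Carlo would only be heuristic (not run).

## (a) Load-bearing analysis — any proof must use …
* the aspect exponent `> 1`: `not_atExponent_of_le_one` (∀ `α ≤ 1`, probability `≥ (1-p_c)^6`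
  at every scale; corner `(m,m,m)` isolated), headline `nearLinearTwoClusterDecay_false_at_aspect_one`;
  this is also the tightness of `CritBoxTwoArmsDecay`'s hypothesis `1 < α`;
* in fact `m - n → ∞`: `not_tendsto_additive_aspect` (∀ fixed `k`, no decay for `(Λ(n), Λ(n+k))`,
  probability `≥ p_c^{2k}(1-p_c)^{6(k+1)}`, two open rays + closed shell); print truth is stronger
  (no decay at `m = Mn` along a scale sequence, vdBvE Prop. 2 — not formalised, multiscale);
* the two arms to `∂ⁱⁿΛ(m)`: `nearLinearTwoClusterDecay_false_without_arms` (origin isolated,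
  `(1-p_c)^6`);
* the distinctness conjunct: dropping it gives `CrossingDecay (7/6)`, which is summit-strength
  (next item) — undecidable here, recorded not refuted;
* criticality from BELOW is not load-bearing: `subcritical_twoCluster_decay` — for every
  `p < p_c` the statement (indeed single-crossing decay, `subcritical_crossing_decay`) is TRUE, by
  the tree's proved sharpness + union bound + translation invariance
  (`real_crossingEvt_le : P_p(cross(n,m)) ≤ (2n+1)³ P_p(0 ↔ ∂Λ(m-n))`); above `p_c` expected true
  by uniqueness in slabs (not formalised) — so a refutation must be a phenomenon AT `p_c`;
* `d = 3 < 6`: not formalisable here (Hara–Slade / Aizenman 1997), see barrier catalogue.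

## (b) Boundary / structure
* `real_twoClusterEvt_pos`, `not_eventually_real_eq_zero`: the event is NON-NULL at every scale
  `1 ≤ n ≤ m` — the crux cannot be closed by an emptiness/nullity argument, and its decay (if
  true) is no faster than `exp(-O(n^{7/6}))`.
* `real_twoClusterEvt_antitone`, `atExponent_mono`: the two-cluster probability is ANTITONE in
  the outer box (`badPair_add_antitone`, first exit), so `{α ≥ 1 | AtExponent α}` is an up-set:
  the crux = "threshold exponent `α* ≤ 7/6`"; our negatives give `α* ≥ 1`; print (site) `α* ≤ 42.17`.
  `atExponent_of_nearLinearTwoClusterDecay` / `nearLinearTwoClusterDecay_of_atExponent`.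
* `real_twoClusterEvt_le_sq`: `P(twoClusterEvt n m) ≤ P(crossingEvt n m)²` for all `n, m`
  (BK via `bk_finitary`; the two clusters carry edge-disjoint open crossings).
* `atExponent_of_crossingDecay` + `percolationContinuityZ3_of_crossingDecay`: the monotone/BK
  road "one crossing already decays" proves `θ(p_c) = 0` OUTRIGHT (`θ ≤ P(crossing)`,
  `DCT16.theta_le_real_siteToBoundary`), so it is not a cheaper route to `U`; `U` is informative
  only in the counterfactual `θ(p_c) > 0` world, where it must be proved WITHOUT crossing decay
  (Cerf-type surgery; print reaches aspect `n^{43}`, site model).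

## (c) Strengthenings refuted
* "eventually null" (`not_eventually_real_eq_zero`), "decay at aspect exponent 1"
  (`nearLinearTwoClusterDecay_false_at_aspect_one`), "decay at bounded additive aspect"
  (`not_tendsto_additive_aspect`).

## (d) Targets: none (payload.stuck_stubs empty).
## (e) Near-miss (the ONLY `sorry` in this file): `not_tendsto_bounded_multiplicative_aspect` —
   the print boundary `m = Mn` (vdBvE 2022 Prop. 2), recorded for orientation, not formalised.
## (f) Numerics (HEURISTIC, no certificate)
* In-dir evidence `NumericsIdeator3.md` (ideator-3, kit jobs j006509/j006511/j006514/j012038/j012044,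
  `p = 0.2488126`, `r ≤ 32`): the number `N` of distinct clusters crossing from scale `r` to `Mr`
  has an `r`-STABLE law for `M ≥ 4` — `E N ≈ 13–18` at `M = 2` (still growing in `r`), `3.7` at
  `M = 4`, `1.7` at `M = 8`, `≈ 1` at `M = 16`; for the BOX event of this crux
  `P(N_box ≥ 2) ≈ 0.92 (M = 4)`, `0.44–0.52 (M = 8, r = 4…12)`; shell version `≈ 0.15–0.25`
  at `M = 16`, `≈ 0.02` at `M = 32` (`r = 4`, 60 samples).  Reading: beyond `M ≈ 4` the
  two-cluster probability falls roughly like `M^{-λ₂}` with `λ₂ ≈ 1–1.6` (consistent with the BK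
  bound `λ₂ ≥ 2λ₁ ≈ 0.95`), i.e. the orthodox decay — but the crux's own aspect `n^{1/6}` is
  `< 2` for `n < 64` and `< 4` for `n < 4096`, where `P ≈ 1`: the asserted decay sets in only at
  `n ≳ 10⁴–10⁵` and then at rate `≈ n^{-λ₂/6} ≈ n^{-0.2}`; it is INVISIBLE to direct simulation
  of the diagonal.  Bounded aspect shows no decay in `r` at any `M` (vdBvE Prop. 2, numerically).
* Own job `j013160` (kit; `mc_two_cluster.py`; the earlier `j005259` sat 6 h in a saturated queue
  and was resubmitted budget-sized): the BOX event exactly as in the crux — diagonal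
  `m = ⌈n^{7/6}⌉`, `n = 4…32` (expected `P(N ≥ 2) ≈ 1` throughout, see above) and aspect scans to
  `M = 6` at `n = 4, 8, 16`; its summary attaches to the item automatically when it ends
  (queued at the time of writing).
-/

namespace Summit.CriticalPhenomena.PercolationContinuityZ3.Cruxes.NearLinearTwoClusterDecay.Disproof

open MeasureTheory Filter Topology
open Literature.Probability.LatticeModels Literature.Probability.Percolation
open Summit.CriticalPhenomena.PercolationContinuityZ3.Theses

noncomputable section

/-- The critical bond-percolation measure `P_{p_c}` on `ℤ³`. [folklore] -/
abbrev critBond : Measure (BondConfig (Site 3)) := bondPercolation (zdGraph 3) (criticalProbI 3)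

/-- The two-distinct-crossing-clusters event of the crux, for inner box `Λ(k)` inside `Λ(m)`:
two sites `x, x' ∈ Λ(k)`, each joined inside `Λ(m)` to the inner vertex boundary of `Λ(m)`,
but not joined to each other inside `Λ(m)`. [folklore] -/
def twoClusterEvt (k m : ℕ) : Set (BondConfig (Site 3)) :=
  {ω | ∃ x ∈ box 3 k, ∃ x' ∈ box 3 k, ∃ y ∈ innerBoundary (zdGraph 3) (box 3 m),
    ∃ y' ∈ innerBoundary (zdGraph 3) (box 3 m),
      ω ∈ openConnIn ↑(box 3 m) x y ∧ ω ∈ openConnIn ↑(box 3 m) x' y' ∧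
        ω ∉ openConnIn ↑(box 3 m) x x'}

/-- The crux family indexed by the aspect exponent `α` (outer box `Λ(⌈n^α⌉)`). [folklore] -/
def AtExponent (α : ℝ) : Prop :=
  Tendsto (fun n : ℕ => critBond.real (twoClusterEvt n ⌈(n : ℝ) ^ α⌉₊)) atTop (𝓝 0)

/-- The crux is literally the instance `α = 7/6`. [folklore] -/
theorem nearLinearTwoClusterDecay_iff :
    PercShatteringRace.NearLinearTwoClusterDecay ↔ AtExponent ((7 : ℝ) / 6) := Iff.rfl

/-- The sibling crux `PercFiniteBoxLRO.CritBoxTwoArmsDecay` (stmt-CriticalPhenomena-0859) is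
literally `∀ α > 1, AtExponent α`. [folklore] -/
theorem critBoxTwoArmsDecay_iff :
    PercFiniteBoxLRO.CritBoxTwoArmsDecay ↔ ∀ α : ℝ, 1 < α → AtExponent α := Iff.rfl

/-! ## Tools -/

/-- `p_c(ℤ³) < 1` (bond), from the tree's proved Grimmett (1.10). [folklore] -/
theorem coe_criticalProbI_three_lt_one : ((criticalProbI 3 : unitInterval) : ℝ) < 1 := by
  rw [coe_criticalProbI]
  exact (Grimmett1999_criticalProb_pos_lt_one_holds 3 (by norm_num)).2

/-- `0 < p_c(ℤ³)` (bond). [folklore] -/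
theorem coe_criticalProbI_three_pos : 0 < ((criticalProbI 3 : unitInterval) : ℝ) := by
  rw [coe_criticalProbI]
  exact (Grimmett1999_criticalProb_pos_lt_one_holds 3 (by norm_num)).1

/-- Isolation: if `ω` uses only lattice edges and every lattice edge at `v` is closed, then `v` is
joined inside no `S` to any `w ≠ v`. [folklore] -/
theorem not_mem_openConnIn_of_incident_closed {ω : BondConfig (Site 3)}
    (hω : ω ⊆ (zdGraph 3).edgeSet) {v w : Site 3} (hvw : v ≠ w)
    (hcl : ∀ e ∈ (zdGraph 3).incidenceFinset v, e ∉ ω) (S : Set (Site 3)) :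
    ω ∉ openConnIn S v w := by
  rintro ⟨hv, hw, h⟩
  have h' : (openGraph ω).Reachable v w := h.map (SimpleGraph.Embedding.induce S).toHom
  obtain ⟨p⟩ := h'
  cases p with
  | nil => exact hvw rfl
  | @cons _ u _ hadj _ =>
    rw [openGraph_adj] at hadj
    have he : (zdGraph 3).Adj v u := (SimpleGraph.mem_edgeSet _).1 (hω hadj.1)
    have hinc : s(v, u) ∈ (zdGraph 3).incidenceFinset v := by
      rw [SimpleGraph.mem_incidenceFinset, SimpleGraph.mk'_mem_incidenceSet_left_iff]
      exact he
    exact hcl _ hinc hadj.1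

/-- Closing a finite set `F` of pairs costs at most `(1 - p_c)^{|F|}`: if every lattice
configuration with all of `F` closed lies in `A`, then `P_{p_c}(A) ≥ (1 - p_c)^{|F|}`. [folklore] -/
theorem pow_card_le_real_of_closed {A : Set (BondConfig (Site 3))} (F : Finset (Sym2 (Site 3)))
    (h : ∀ ω : BondConfig (Site 3), ω ⊆ (zdGraph 3).edgeSet → (∀ e ∈ F, e ∉ ω) → ω ∈ A) :
    (1 - (criticalProbI 3 : ℝ)) ^ F.card ≤ critBond.real A := by
  have hae : ∀ᵐ ω ∂critBond, ω ⊆ (zdGraph 3).edgeSet :=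
    ProbabilityTheory.setBernoulli_ae_subset
  have hle : {ω : BondConfig (Site 3) | ∀ e ∈ F, e ∉ ω} ≤ᵐ[critBond] A :=
    hae.mono fun ω hω => show (ω ∈ {ω : BondConfig (Site 3) | ∀ e ∈ F, e ∉ ω}) → ω ∈ A from
      fun hF => h ω hω hF
  calc (1 - (criticalProbI 3 : ℝ)) ^ F.card
      ≤ critBond.real {ω | ∀ e ∈ F, e ∉ ω} := le_bondPercolation_real_forall_notMem _ _ F
    _ ≤ critBond.real A := by
        simp only [measureReal_def]
        exact ENNReal.toReal_mono (measure_ne_top _ _) (measure_mono_ae hle)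

/-- Every site of `ℤ³` has exactly `6` incident lattice edges. [folklore] -/
theorem card_incidenceFinset_zdGraph_three (v : Site 3) :
    ((zdGraph 3).incidenceFinset v).card = 6 := by
  classical
  rw [SimpleGraph.card_incidenceFinset_eq_degree, ← SimpleGraph.card_neighborFinset_eq_degree]
  have := card_neighborFinset_zdGraph_holds (d := 3) v
  convert this using 1

/-! ## Geometry of the corner `(m,m,m)` -/

/-- The corner `(m, m, m)` of `Λ(m)`. [folklore] -/
def corner (m : ℕ) : Site 3 := fun _ => (m : ℤ)

/-- The corner of `Λ(m)` lies in every `Λ(n)`, `n ≥ m`. [folklore] -/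
theorem corner_mem_box {m n : ℕ} (h : m ≤ n) : corner m ∈ box 3 n := by
  rw [mem_box]; intro i; simp only [corner]; omega

/-- The opposite corner `-(m,m,m)` lies in every `Λ(n)`, `n ≥ m`. [folklore] -/
theorem neg_corner_mem_box {m n : ℕ} (h : m ≤ n) : -corner m ∈ box 3 n := by
  rw [mem_box]; intro i; simp only [corner, Pi.neg_apply]; omega

/-- `(m,m,m) ∈ ∂ⁱⁿΛ(m)` (its neighbour `(m+1,m,m)` is outside). [folklore] -/
theorem corner_mem_innerBoundary (m : ℕ) : corner m ∈ innerBoundary (zdGraph 3) (box 3 m) := by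
  rw [mem_innerBoundary_iff]
  refine ⟨corner_mem_box le_rfl, corner m + Pi.single 0 1, ?_, ?_⟩
  · intro h
    rw [mem_box] at h
    have := (h 0).2
    simp only [corner, Pi.add_apply, Pi.single_eq_same] at this
    omega
  · rw [zdGraph_adj_iff]; exact ⟨0, Or.inl rfl⟩

/-- `-(m,m,m) ∈ ∂ⁱⁿΛ(m)`. [folklore] -/
theorem neg_corner_mem_innerBoundary (m : ℕ) : -corner m ∈ innerBoundary (zdGraph 3) (box 3 m) := by
  rw [mem_innerBoundary_iff]
  refine ⟨neg_corner_mem_box le_rfl, -corner m - Pi.single 0 1, ?_, ?_⟩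
  · intro h
    rw [mem_box] at h
    have := (h 0).1
    simp only [corner, Pi.sub_apply, Pi.neg_apply, Pi.single_eq_same] at this
    omega
  · rw [zdGraph_adj_iff]; exact ⟨0, Or.inr (by simp)⟩

/-- The two corners differ once `m ≥ 1`. [folklore] -/
theorem corner_ne_neg {m : ℕ} (hm : 1 ≤ m) : corner m ≠ -corner m := by
  intro h
  have := congr_fun h 0
  simp only [corner, Pi.neg_apply] at this
  omega

/-! ## (a) Load-bearing analysis I: the aspect exponent must exceed `1` -/

/-- At aspect exponent `≤ 1` the event has probability `≥ (1 - p_c)^6` at every scale: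
with `1 ≤ m ≤ n`, the corner `(m,m,m)` lies in `Λ(n) ∩ ∂ⁱⁿΛ(m)`, is (reflexively) joined to the
boundary, and is cut from `-(m,m,m)` as soon as its six edges are closed. [folklore] -/
theorem real_twoClusterEvt_ge {n m : ℕ} (hm1 : 1 ≤ m) (hmn : m ≤ n) :
    (1 - (criticalProbI 3 : ℝ)) ^ 6 ≤ critBond.real (twoClusterEvt n m) := by
  classical
  rw [← card_incidenceFinset_zdGraph_three (corner m)]
  apply pow_card_le_real_of_closed
  intro ω hω hF
  refine ⟨corner m, corner_mem_box hmn, -corner m, neg_corner_mem_box hmn, corner m,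
    corner_mem_innerBoundary m, -corner m, neg_corner_mem_innerBoundary m, ?_, ?_, ?_⟩
  · exact ⟨Finset.mem_coe.2 (corner_mem_box le_rfl), Finset.mem_coe.2 (corner_mem_box le_rfl),
      SimpleGraph.Reachable.refl _⟩
  · exact ⟨Finset.mem_coe.2 (neg_corner_mem_box le_rfl),
      Finset.mem_coe.2 (neg_corner_mem_box le_rfl), SimpleGraph.Reachable.refl _⟩
  · exact not_mem_openConnIn_of_incident_closed hω (corner_ne_neg hm1) hF _

/-- **Any proof must use `α > 1`.** For every aspect exponent `α ≤ 1` (in particular `α = 1`,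
outer box = inner box) the two-cluster probability stays `≥ (1 - p_c)^6`, so it does not tend
to `0`: `CritBoxTwoArmsDecay`'s hypothesis `1 < α` cannot be weakened to `1 ≤ α`, and the crux
`U(1/6)` is the `b = 1/6` member of a family that is FALSE at `b ≤ 0`. [folklore] -/
theorem not_atExponent_of_le_one {α : ℝ} (hα : α ≤ 1) : ¬ AtExponent α := by
  intro h
  have hc : 0 < (1 - (criticalProbI 3 : ℝ)) ^ 6 := pow_pos (sub_pos.2 coe_criticalProbI_three_lt_one) 6
  obtain ⟨n, hlt, hn⟩ := ((h.eventually (Iio_mem_nhds hc)).and (eventually_ge_atTop 1)).exists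
  have hn' : (1 : ℝ) ≤ n := by exact_mod_cast hn
  have hm_le : ⌈(n : ℝ) ^ α⌉₊ ≤ n := by
    refine Nat.ceil_le.2 ?_
    calc (n : ℝ) ^ α ≤ (n : ℝ) ^ (1 : ℝ) := Real.rpow_le_rpow_of_exponent_le hn' hα
      _ = n := Real.rpow_one _
  have hm_pos : 1 ≤ ⌈(n : ℝ) ^ α⌉₊ :=
    Nat.lt_ceil.2 (by simpa using Real.rpow_pos_of_pos (by positivity : (0 : ℝ) < n) α)
  exact absurd (real_twoClusterEvt_ge hm_pos hm_le) (not_le.2 hlt)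

/-- The headline instance: the crux with `7/6` replaced by `1`. [folklore] -/
def NearLinearTwoClusterDecayAtAspectOne : Prop :=
  Tendsto (fun n : ℕ => (bondPercolation (zdGraph 3) (criticalProbI 3)).real
    {ω | ∃ x ∈ box 3 n, ∃ x' ∈ box 3 n, ∃ y ∈ innerBoundary (zdGraph 3) (box 3 ⌈(n : ℝ) ^ (1 : ℝ)⌉₊),
      ∃ y' ∈ innerBoundary (zdGraph 3) (box 3 ⌈(n : ℝ) ^ (1 : ℝ)⌉₊),
        ω ∈ openConnIn ↑(box 3 ⌈(n : ℝ) ^ (1 : ℝ)⌉₊) x y ∧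
        ω ∈ openConnIn ↑(box 3 ⌈(n : ℝ) ^ (1 : ℝ)⌉₊) x' y' ∧
        ω ∉ openConnIn ↑(box 3 ⌈(n : ℝ) ^ (1 : ℝ)⌉₊) x x'}) atTop (𝓝 0)

/-- **The crux at aspect exponent `1` is false.** [folklore] -/
theorem nearLinearTwoClusterDecay_false_at_aspect_one : ¬ NearLinearTwoClusterDecayAtAspectOne :=
  not_atExponent_of_le_one le_rfl

/-! ## (a) Load-bearing analysis II: the two arms to `∂ⁱⁿΛ(m)` cannot be dropped -/

/-- The crux with the two boundary-connection conjuncts dropped: "two sites of `Λ(n)` not joined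
inside `Λ(⌈n^{7/6}⌉)`" has vanishing probability. [folklore] -/
def NearLinearTwoClusterDecayWithoutArms : Prop :=
  Tendsto (fun n : ℕ => (bondPercolation (zdGraph 3) (criticalProbI 3)).real
    {ω | ∃ x ∈ box 3 n, ∃ x' ∈ box 3 n,
      ω ∉ openConnIn ↑(box 3 ⌈(n : ℝ) ^ ((7 : ℝ) / 6)⌉₊) x x'}) atTop (𝓝 0)

/-- `e₀ = (1,0,0) ∈ Λ(n)` for `n ≥ 1`. [folklore] -/
theorem single_mem_box {n : ℕ} (hn : 1 ≤ n) : (Pi.single 0 1 : Site 3) ∈ box 3 n := by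
  rw [mem_box]; intro i
  by_cases hi : i = 0
  · subst hi; simp; omega
  · simp [hi]

/-- `P_{p_c}(∃ x, x' ∈ Λ(n) not joined inside S) ≥ (1 - p_c)^6` for `n ≥ 1`: close the six edges at the origin. [folklore] -/
theorem real_noConn_ge {n : ℕ} (hn : 1 ≤ n) (S : Set (Site 3)) :
    (1 - (criticalProbI 3 : ℝ)) ^ 6 ≤
      critBond.real {ω | ∃ x ∈ box 3 n, ∃ x' ∈ box 3 n, ω ∉ openConnIn S x x'} := by
  classical
  rw [← card_incidenceFinset_zdGraph_three (0 : Site 3)]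
  apply pow_card_le_real_of_closed
  intro ω hω hF
  refine ⟨0, zero_mem_box 3 n, Pi.single 0 1, single_mem_box hn, ?_⟩
  refine not_mem_openConnIn_of_incident_closed hω ?_ hF S
  intro h
  have := congr_fun h 0
  simp at this

/-- **Any proof must use the arms.** Without the two connections to `∂ⁱⁿΛ(m)` the event
contains "the origin is isolated", of probability `(1 - p_c)^6 > 0` at every scale. [folklore] -/
theorem nearLinearTwoClusterDecay_false_without_arms : ¬ NearLinearTwoClusterDecayWithoutArms := by
  intro h
  have hc : 0 < (1 - (criticalProbI 3 : ℝ)) ^ 6 := pow_pos (sub_pos.2 coe_criticalProbI_three_lt_one) 6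
  obtain ⟨n, hlt, hn⟩ := ((h.eventually (Iio_mem_nhds hc)).and (eventually_ge_atTop 1)).exists
  exact absurd (real_noConn_ge hn _) (not_le.2 hlt)


/-! ## (b)/(c) Tightness towards the true boundary and non-nullness at every scale

Two straight open rays `(n,0,0) → (n+k,0,0)` and `(-n,0,0) → (-(n+k),0,0)`, the positive one wrapped
in closed edges, realise the two-cluster event of `(Λ(n), Λ(n+k))` with probability
`≥ p_c^{2k} (1-p_c)^{6(k+1)}`, uniformly in `n ≥ 1`. Consequences: the event is non-null at
every scale (the crux cannot be closed by an emptiness/nullity argument), and the two-cluster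
probability does NOT decay at any bounded ADDITIVE aspect `m = n + k` — any proof must let
`m - n → ∞` (in print the truth is stronger: no decay at bounded MULTIPLICATIVE aspect `m = Mn`
along a scale sequence, van den Berg–van Engelenburg arXiv:2009.13337 Prop. 2). -/

/-- The axis site `(j, 0, 0)`. [folklore] -/
def ax (j : ℤ) : Site 3 := Pi.single 0 j

/-- First coordinate of the axis site. [folklore] -/
theorem ax_apply_zero (j : ℤ) : ax j 0 = j := by simp [ax]

/-- The other coordinates of the axis site vanish. [folklore] -/
theorem ax_apply_ne {i : Fin 3} (hi : i ≠ 0) (j : ℤ) : ax j i = 0 := by simp [ax, hi]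

/-- `j ↦ (j,0,0)` is injective. [folklore] -/
theorem ax_injective : Function.Injective ax := fun i j h => by
  simpa [ax] using congr_fun h 0

/-- `(j,0,0) ∈ Λ(m)` iff `|j| ≤ m` (the `if` direction). [folklore] -/
theorem ax_mem_box {j : ℤ} {m : ℕ} (h1 : -(m : ℤ) ≤ j) (h2 : j ≤ m) : ax j ∈ box 3 m := by
  rw [mem_box]; intro i
  by_cases hi : i = 0
  · subst hi; rw [ax_apply_zero]; exact ⟨h1, h2⟩
  · rw [ax_apply_ne hi]; omega

/-- `(j,0,0) ∈ Λ(m)` iff `|j| ≤ m`. [folklore] -/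
theorem ax_mem_box_iff {j : ℤ} {m : ℕ} : ax j ∈ box 3 m ↔ -(m : ℤ) ≤ j ∧ j ≤ m := by
  refine ⟨fun h => ?_, fun h => ax_mem_box h.1 h.2⟩
  rw [mem_box] at h
  simpa [ax_apply_zero] using h 0

/-- `(j+1,0,0) = (j,0,0) + e₀`. [folklore] -/
theorem ax_succ (j : ℤ) : ax (j + 1) = ax j + Pi.single 0 1 := by
  simp only [ax]
  exact Pi.single_add (f := fun _ : Fin 3 => ℤ) 0 j 1

/-- Consecutive axis sites are lattice neighbours. [folklore] -/
theorem zdGraph_adj_ax_succ (j : ℤ) : (zdGraph 3).Adj (ax j) (ax (j + 1)) := by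
  rw [zdGraph_adj_iff]; exact ⟨0, Or.inl (ax_succ j)⟩

/-- `(m,0,0) ∈ ∂ⁱⁿΛ(m)`. [folklore] -/
theorem ax_mem_innerBoundary (m : ℕ) : ax m ∈ innerBoundary (zdGraph 3) (box 3 m) := by
  rw [mem_innerBoundary_iff]
  refine ⟨ax_mem_box (by omega) le_rfl, ax (m + 1), ?_, zdGraph_adj_ax_succ m⟩
  rw [ax_mem_box_iff]; omega

/-- `(-m,0,0) ∈ ∂ⁱⁿΛ(m)`. [folklore] -/
theorem ax_neg_mem_innerBoundary (m : ℕ) : ax (-(m : ℤ)) ∈ innerBoundary (zdGraph 3) (box 3 m) := by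
  rw [mem_innerBoundary_iff]
  refine ⟨ax_mem_box le_rfl (by omega), ax (-(m : ℤ) - 1), ?_, ?_⟩
  · rw [ax_mem_box_iff]; omega
  · have h := (zdGraph_adj_ax_succ (-(m : ℤ) - 1)).symm
    rwa [sub_add_cancel] at h

/-- The open edges of the construction: the two rays. [folklore] -/
def rayEdges (n k : ℕ) : Finset (Sym2 (Site 3)) :=
  (Finset.Ico (n : ℤ) (n + k) ∪ Finset.Ico (-((n : ℤ) + k)) (-(n : ℤ))).image
    fun j => s(ax j, ax (j + 1))

/-- The closed edges of the construction: every lattice edge at the positive ray other than the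
ray's own edges. [folklore] -/
def shellEdges (n k : ℕ) : Finset (Sym2 (Site 3)) :=
  ((Finset.Icc (n : ℤ) (n + k)).biUnion fun j => (zdGraph 3).incidenceFinset (ax j)) \ rayEdges n k

/-- Membership in `rayEdges`. [folklore] -/
theorem mem_rayEdges {n k : ℕ} {e : Sym2 (Site 3)} :
    e ∈ rayEdges n k ↔ ∃ j : ℤ, (((n : ℤ) ≤ j ∧ j < n + k) ∨ (-((n : ℤ) + k) ≤ j ∧ j < -(n : ℤ))) ∧
      s(ax j, ax (j + 1)) = e := by
  simp [rayEdges]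

/-- The ray edges are lattice edges. [folklore] -/
theorem rayEdges_subset_edgeSet (n k : ℕ) : (↑(rayEdges n k) : Set (Sym2 (Site 3))) ⊆ (zdGraph 3).edgeSet := by
  intro e he
  obtain ⟨j, -, rfl⟩ := mem_rayEdges.1 (Finset.mem_coe.1 he)
  exact (SimpleGraph.mem_edgeSet _).2 (zdGraph_adj_ax_succ j)

/-- At most `2k` ray edges. [folklore] -/
theorem card_rayEdges_le (n k : ℕ) : (rayEdges n k).card ≤ 2 * k := by
  refine (Finset.card_image_le).trans ((Finset.card_union_le _ _).trans ?_)
  rw [Int.card_Ico, Int.card_Ico]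
  omega

/-- At most `6(k+1)` shell edges. [folklore] -/
theorem card_shellEdges_le (n k : ℕ) : (shellEdges n k).card ≤ 6 * (k + 1) := by
  classical
  refine (Finset.card_le_card Finset.sdiff_subset).trans (Finset.card_biUnion_le.trans ?_)
  simp only [card_incidenceFinset_zdGraph_three, Finset.sum_const, smul_eq_mul, Int.card_Icc]
  omega

/-- The event "rays open, shell closed" is determined by finitely many edges (for independence). [folklore] -/
theorem determinedBy_setOf_finsetSubset (F : Finset (Sym2 (Site 3))) :
    DeterminedBy {ω : BondConfig (Site 3) | (↑F : Set (Sym2 (Site 3))) ⊆ ω} ↑F := by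
  rw [determinedBy_iff]
  intro ω ω' h
  simp only [Set.mem_setOf_eq]
  constructor
  · intro hω e he
    exact ((Set.ext_iff.1 h e).1 ⟨hω he, he⟩).1
  · intro hω' e he
    exact ((Set.ext_iff.1 h e).2 ⟨hω' he, he⟩).1

/-- Along the positive ray. [folklore] -/
theorem pathIn_posRay {ω : BondConfig (Site 3)} {n k : ℕ}
    (hO : (↑(rayEdges n k) : Set (Sym2 (Site 3))) ⊆ ω) :
    ∀ i : ℕ, i ≤ k → PathIn (openGraph ω) ↑(box 3 (n + k)) (ax n) (ax ((n : ℤ) + i)) := by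
  intro i
  induction i with
  | zero =>
    intro _
    simpa using PathIn.refl (G := openGraph ω) (Finset.mem_coe.2 (ax_mem_box (j := (n : ℤ)) (m := n + k) (by omega) (by omega)))
  | succ i ih =>
    intro hi
    have hprev := ih (Nat.le_of_succ_le hi)
    refine hprev.tail ?_ (Finset.mem_coe.2 (ax_mem_box (by omega) (by omega)))
    rw [openGraph_adj]
    refine ⟨hO (Finset.mem_coe.2 (mem_rayEdges.2 ⟨(n : ℤ) + i, Or.inl ⟨by omega, by omega⟩, ?_⟩)),
      ax_injective.ne (by omega)⟩
    push_cast; ring_nf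

/-- Along the negative ray. [folklore] -/
theorem pathIn_negRay {ω : BondConfig (Site 3)} {n k : ℕ}
    (hO : (↑(rayEdges n k) : Set (Sym2 (Site 3))) ⊆ ω) :
    ∀ i : ℕ, i ≤ k → PathIn (openGraph ω) ↑(box 3 (n + k)) (ax (-(n : ℤ))) (ax (-(n : ℤ) - i)) := by
  intro i
  induction i with
  | zero =>
    intro _
    simpa using PathIn.refl (G := openGraph ω) (Finset.mem_coe.2 (ax_mem_box (j := -(n : ℤ)) (m := n + k) (by omega) (by omega)))
  | succ i ih =>
    intro hi
    have hprev := ih (Nat.le_of_succ_le hi)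
    refine hprev.tail ?_ (Finset.mem_coe.2 (ax_mem_box (by omega) (by omega)))
    rw [openGraph_adj]
    refine ⟨?_, ax_injective.ne (by omega)⟩
    have hmem : s(ax (-(n : ℤ) - i - 1), ax (-(n : ℤ) - i - 1 + 1)) ∈ rayEdges n k :=
      mem_rayEdges.2 ⟨-(n : ℤ) - i - 1, Or.inr ⟨by omega, by omega⟩, rfl⟩
    have := hO (Finset.mem_coe.2 hmem)
    rw [sub_add_cancel, Sym2.eq_swap] at this
    convert this using 3
    push_cast; ring

/-- The positive ray is a whole cluster: nothing escapes it when the shell is closed. [folklore] -/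
theorem not_openConnIn_ax_neg {ω : BondConfig (Site 3)} (hω : ω ⊆ (zdGraph 3).edgeSet) {n k : ℕ}
    (hn : 1 ≤ n) (hC : ∀ e ∈ shellEdges n k, e ∉ ω) (S : Set (Site 3)) :
    ω ∉ openConnIn S (ax n) (ax (-(n : ℤ))) := by
  classical
  intro h
  rw [DCT16.mem_openConnIn_iff_pathIn] at h
  have key := DCT16.pathIn_induction (fun v => ∃ j : ℤ, (n : ℤ) ≤ j ∧ j ≤ n + k ∧ v = ax j) h
    ⟨n, le_rfl, by omega, rfl⟩ ?_
  · obtain ⟨j, hj1, -, hj⟩ := key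
    have := ax_injective hj
    omega
  · rintro a b - - ⟨j, hj1, hj2, rfl⟩ hadj
    rw [openGraph_adj] at hadj
    have hlat : (zdGraph 3).Adj (ax j) b := (SimpleGraph.mem_edgeSet _).1 (hω hadj.1)
    have hinc : s(ax j, b) ∈ (zdGraph 3).incidenceFinset (ax j) := by
      rw [SimpleGraph.mem_incidenceFinset, SimpleGraph.mk'_mem_incidenceSet_left_iff]; exact hlat
    have hbi : s(ax j, b) ∈ (Finset.Icc (n : ℤ) (n + k)).biUnion
        fun j => (zdGraph 3).incidenceFinset (ax j) :=
      Finset.mem_biUnion.2 ⟨j, Finset.mem_Icc.2 ⟨hj1, hj2⟩, hinc⟩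
    by_cases hray : s(ax j, b) ∈ rayEdges n k
    · obtain ⟨i, hi, hie⟩ := mem_rayEdges.1 hray
      rcases Sym2.eq_iff.1 hie with ⟨h1, h2⟩ | ⟨h1, h2⟩
      · have := ax_injective h1
        subst this
        exact ⟨i + 1, by omega, by omega, h2.symm⟩
      · have := ax_injective h2
        exact ⟨i, by omega, by omega, h1.symm⟩
    · exact (hC _ (Finset.mem_sdiff.2 ⟨hbi, hray⟩) hadj.1).elim

/-- On "rays open, shell closed" (and `ω ⊆ E(ℤ³)`) the two-cluster event of `(Λ(n), Λ(n+k))`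
occurs, `n ≥ 1`. [folklore] -/
theorem twoClusterEvt_of_rays {ω : BondConfig (Site 3)} (hω : ω ⊆ (zdGraph 3).edgeSet) {n k : ℕ}
    (hn : 1 ≤ n) (hO : (↑(rayEdges n k) : Set (Sym2 (Site 3))) ⊆ ω)
    (hC : ∀ e ∈ shellEdges n k, e ∉ ω) : ω ∈ twoClusterEvt n (n + k) := by
  refine ⟨ax n, ax_mem_box (by omega) le_rfl, ax (-(n : ℤ)), ax_mem_box le_rfl (by omega),
    ax ((n : ℤ) + k), ?_, ax (-(n : ℤ) - k), ?_, ?_, ?_, not_openConnIn_ax_neg hω hn hC _⟩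
  · exact_mod_cast ax_mem_innerBoundary (n + k)
  · have := ax_neg_mem_innerBoundary (n + k)
    convert this using 2; push_cast; ring
  · exact DCT16.mem_openConnIn_iff_pathIn.2 (pathIn_posRay hO k le_rfl)
  · exact DCT16.mem_openConnIn_iff_pathIn.2 (pathIn_negRay hO k le_rfl)

/-- **Quantitative non-nullness, uniform in `n`**: for `n ≥ 1` and every `k`,
`P_{p_c}(two-cluster event of (Λ(n), Λ(n+k))) ≥ p_c^{2k} (1 - p_c)^{6(k+1)}`. [folklore] -/
theorem real_twoClusterEvt_add_ge {n : ℕ} (hn : 1 ≤ n) (k : ℕ) :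
    (criticalProbI 3 : ℝ) ^ (2 * k) * (1 - (criticalProbI 3 : ℝ)) ^ (6 * (k + 1)) ≤
      critBond.real (twoClusterEvt n (n + k)) := by
  classical
  set p : unitInterval := criticalProbI 3 with hp
  have hp0 : 0 ≤ (p : ℝ) := p.2.1
  have hp1 : (p : ℝ) ≤ 1 := p.2.2
  have hdisj : Disjoint (↑(rayEdges n k) : Set (Sym2 (Site 3))) ↑(shellEdges n k) := by
    rw [Finset.disjoint_coe]; exact Finset.disjoint_sdiff
  have hindep := bondPercolation_real_inter_of_disjoint (zdGraph 3) p hdisj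
    (determinedBy_setOf_finsetSubset (rayEdges n k)) (determinedBy_forall_notMem (shellEdges n k))
    ((determinedBy_setOf_finsetSubset (rayEdges n k)).measurableSet_of_finset)
    (measurableSet_forall_notMem (shellEdges n k))
  have h1 : critBond.real {ω | (↑(rayEdges n k) : Set (Sym2 (Site 3))) ⊆ ω} = (p : ℝ) ^ (rayEdges n k).card :=
    bondPercolation_real_setOf_subset _ _ _ (rayEdges_subset_edgeSet n k)
  have h2 : (1 - (p : ℝ)) ^ (shellEdges n k).card ≤ critBond.real {ω | ∀ e ∈ shellEdges n k, e ∉ ω} :=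
    le_bondPercolation_real_forall_notMem _ _ _
  calc (p : ℝ) ^ (2 * k) * (1 - (p : ℝ)) ^ (6 * (k + 1))
      ≤ (p : ℝ) ^ (rayEdges n k).card * (1 - (p : ℝ)) ^ (shellEdges n k).card :=
        mul_le_mul (pow_le_pow_of_le_one hp0 hp1 (card_rayEdges_le n k))
          (pow_le_pow_of_le_one (sub_nonneg.2 hp1) (sub_le_self _ hp0) (card_shellEdges_le n k))
          (by positivity) (by positivity)
    _ ≤ critBond.real {ω | (↑(rayEdges n k) : Set (Sym2 (Site 3))) ⊆ ω} *
          critBond.real {ω | ∀ e ∈ shellEdges n k, e ∉ ω} := by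
        rw [h1]; exact mul_le_mul_of_nonneg_left h2 (by positivity)
    _ = critBond.real ({ω | (↑(rayEdges n k) : Set (Sym2 (Site 3))) ⊆ ω} ∩
          {ω | ∀ e ∈ shellEdges n k, e ∉ ω}) := hindep.symm
    _ ≤ critBond.real (twoClusterEvt n (n + k)) :=
        DCT16.real_mono_of_forall_subset_edgeSet _ _ fun ω hω hmem =>
          twoClusterEvt_of_rays hω hn hmem.1 hmem.2

/-- **(c) The event is non-null at every scale**: `P_{p_c}(two-cluster event of (Λ(n), Λ(m))) > 0`
whenever `1 ≤ n ≤ m`; the crux is not closable by showing the event empty or null. [folklore] -/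
theorem real_twoClusterEvt_pos {n m : ℕ} (hn : 1 ≤ n) (hnm : n ≤ m) :
    0 < critBond.real (twoClusterEvt n m) := by
  obtain ⟨k, rfl⟩ := Nat.exists_eq_add_of_le hnm
  refine lt_of_lt_of_le ?_ (real_twoClusterEvt_add_ge hn k)
  have h0 := coe_criticalProbI_three_pos
  have h1 := coe_criticalProbI_three_lt_one
  positivity

/-- The natural strengthening "the crux event is eventually NULL" is false. [folklore] -/
theorem not_eventually_real_eq_zero :
    ¬ ∀ᶠ n : ℕ in atTop, critBond.real (twoClusterEvt n ⌈(n : ℝ) ^ ((7 : ℝ) / 6)⌉₊) = 0 := by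
  intro h
  obtain ⟨n, h0, hn⟩ := (h.and (eventually_ge_atTop 1)).exists
  have hn' : (1 : ℝ) ≤ n := by exact_mod_cast hn
  have hpow : (n : ℝ) ≤ (n : ℝ) ^ ((7 : ℝ) / 6) := by
    calc (n : ℝ) = (n : ℝ) ^ (1 : ℝ) := (Real.rpow_one _).symm
      _ ≤ (n : ℝ) ^ ((7 : ℝ) / 6) := Real.rpow_le_rpow_of_exponent_le hn' (by norm_num)
  have hle : n ≤ ⌈(n : ℝ) ^ ((7 : ℝ) / 6)⌉₊ := by
    calc n = ⌈((n : ℕ) : ℝ)⌉₊ := (Nat.ceil_natCast n).symm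
      _ ≤ ⌈(n : ℝ) ^ ((7 : ℝ) / 6)⌉₊ := Nat.ceil_mono hpow
  exact (real_twoClusterEvt_pos hn hle).ne' h0

/-- **(b) Tightness towards the boundary: no decay at any bounded additive aspect.** For every
fixed `k`, the two-cluster probability of `(Λ(n), Λ(n+k))` stays `≥ p_c^{2k}(1-p_c)^{6(k+1)} > 0`;
any proof of the crux must use `m - n → ∞` (print: even `m/n → ∞` is needed, vdBvE 2022 Prop. 2). [folklore] -/
theorem not_tendsto_additive_aspect (k : ℕ) :
    ¬ Tendsto (fun n : ℕ => critBond.real (twoClusterEvt n (n + k))) atTop (𝓝 0) := by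
  intro h
  have hc : 0 < (criticalProbI 3 : ℝ) ^ (2 * k) * (1 - (criticalProbI 3 : ℝ)) ^ (6 * (k + 1)) := by
    have h0 := coe_criticalProbI_three_pos
    have h1 := coe_criticalProbI_three_lt_one
    positivity
  obtain ⟨n, hlt, hn⟩ := ((h.eventually (Iio_mem_nhds hc)).and (eventually_ge_atTop 1)).exists
  exact absurd (real_twoClusterEvt_add_ge hn k) (not_le.2 hlt)

/-! ## (b) The monotone road to the crux is summit-hard

The crux event is contained in the single-crossing event `{Λ(n) ↔ ∂ⁱⁿΛ(m) in Λ(m)}`, so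
"crossing decay at aspect `7/6`" implies the crux by monotonicity (and the square of the crossing
probability bounds it, by BK). But crossing decay at ANY aspect already implies `θ(p_c) = 0`,
the summit conjunct itself: the only world in which the crux carries information for the race is
the counterfactual `θ(p_c) > 0` world, where crossing probabilities do not decay at all. -/

/-- The single-crossing event of the annulus `(Λ(n), Λ(m))`, inside `Λ(m)`. [folklore] -/
def crossingEvt (n m : ℕ) : Set (BondConfig (Site 3)) :=
  {ω | ∃ x ∈ box 3 n, ∃ y ∈ innerBoundary (zdGraph 3) (box 3 m), ω ∈ openConnIn ↑(box 3 m) x y}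

/-- Crossing decay at exponent `α`. [folklore] -/
def CrossingDecay (α : ℝ) : Prop :=
  Tendsto (fun n : ℕ => critBond.real (crossingEvt n ⌈(n : ℝ) ^ α⌉₊)) atTop (𝓝 0)

/-- Two distinct crossing clusters give in particular one crossing. [folklore] -/
theorem twoClusterEvt_subset_crossingEvt (n m : ℕ) : twoClusterEvt n m ⊆ crossingEvt n m :=
  fun _ ⟨x, hx, _, _, y, hy, _, _, hxy, _, _⟩ => ⟨x, hx, y, hy, hxy⟩

/-- Crossing decay implies the crux family member, by monotonicity. [folklore] -/
theorem atExponent_of_crossingDecay {α : ℝ} (h : CrossingDecay α) : AtExponent α := by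
  refine squeeze_zero (fun n => measureReal_nonneg) (fun n => ?_) h
  exact measureReal_mono (twoClusterEvt_subset_crossingEvt _ _)

/-- `θ(p_c) ≤ P_{p_c}(crossing of (Λ(n), Λ(m)))` for every `n, m`: the one-arm event of the origin
is a crossing. [folklore] -/
theorem theta_le_real_crossingEvt (n m : ℕ) :
    theta (zdGraph 3) 0 (criticalProbI 3) ≤ critBond.real (crossingEvt n m) := by
  refine (DCT16.theta_le_real_siteToBoundary (criticalProbI 3) m).trans (measureReal_mono ?_)
  rintro ω ⟨y, hy, hω⟩
  exact ⟨0, zero_mem_box 3 n, y, hy, hω⟩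

/-- **Crossing decay at any exponent proves the summit conjunct** `θ(p_c) = 0` on `ℤ³`. [folklore] -/
theorem percolationContinuityZ3_of_crossingDecay {α : ℝ} (h : CrossingDecay α) :
    _root_.PercolationContinuityZ3 := by
  show Literature.Probability.Percolation.PercolationContinuityZ3
  rw [percolationContinuityZ3_iff]
  refine le_antisymm ?_ measureReal_nonneg
  exact ge_of_tendsto' h fun n => theta_le_real_crossingEvt n _


/-! ## (b) Quantitative reduction: `P(two clusters) ≤ P(one crossing)²` (BK)

Two distinct crossing clusters carry edge-DISJOINT open crossings, so the crux event lies in the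
disjoint occurrence `crossingEvt □ crossingEvt`, and the tree's BK inequality for finitary
increasing events (`bk_finitary`) squares the crossing probability: in the orthodox picture
(`P(Λ(n) ↔ ∂Λ(n^{7/6})) ≈ n^{-0.08}`) the crux probability decays like `n^{-0.16}` or faster. -/

/-- Finite open witness of an open path inside `S`, together with the cluster invariant: every
endpoint of a witness edge is joined to the start inside `S`. [folklore] -/
theorem exists_finset_witness_of_pathIn {ω : BondConfig (Site 3)} {S : Set (Site 3)} {x y : Site 3}
    (h : PathIn (openGraph ω) S x y) :
    ∃ K : Finset (Sym2 (Site 3)), (↑K : Set (Sym2 (Site 3))) ⊆ ω ∧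
      PathIn (openGraph (↑K : Set (Sym2 (Site 3)))) S x y ∧
      ∀ e ∈ K, ∀ v ∈ e, PathIn (openGraph ω) S x v := by
  classical
  obtain ⟨hx, hr⟩ := h
  induction hr with
  | refl => exact ⟨∅, by simp, PathIn.refl hx, by simp⟩
  | @tail b c hxb hbc ih =>
    obtain ⟨K, hKω, hK, hinv⟩ := ih
    have hb : PathIn (openGraph ω) S x b := ⟨hx, hxb⟩
    have hadj := (openGraph_adj ω b c).1 hbc.1
    refine ⟨insert s(b, c) K, ?_, ?_, ?_⟩
    · rw [Finset.coe_insert]; exact Set.insert_subset hadj.1 hKω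
    · refine (hK.mono_graph (openGraph_mono ?_)).tail ?_ hbc.2
      · rw [Finset.coe_insert]; exact Set.subset_insert _ _
      · rw [openGraph_adj, Finset.coe_insert]; exact ⟨Set.mem_insert _ _, hadj.2⟩
    · intro e he v hv
      rcases Finset.mem_insert.1 he with rfl | he
      · rcases Sym2.mem_iff.1 hv with rfl | rfl
        · exact hb
        · exact hb.tail hbc.1 hbc.2
      · exact hinv e he v hv

/-- The single-crossing event is increasing. [folklore] -/
theorem isUpperSet_crossingEvt (n m : ℕ) : IsUpperSet (crossingEvt n m) := by
  rintro ω ω' hle ⟨x, hx, y, hy, h⟩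
  exact ⟨x, hx, y, hy, isUpperSet_openConnIn _ _ _ hle h⟩

/-- The single-crossing event is finitary (witnessed by the finitely many edges of an open path). [folklore] -/
theorem isFinitary_crossingEvt (n m : ℕ) : IsFinitary (crossingEvt n m) := by
  rintro ω ⟨x, hx, y, hy, h⟩
  obtain ⟨K, hKω, hK, -⟩ := exists_finset_witness_of_pathIn (DCT16.mem_openConnIn_iff_pathIn.1 h)
  exact ⟨K, hKω, x, hx, y, hy, DCT16.mem_openConnIn_iff_pathIn.2 hK⟩

/-- **Two distinct crossing clusters occur disjointly**: `twoClusterEvt ⊆ crossingEvt □ crossingEvt`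
(the open witnesses of the two crossings are edge-disjoint, since a common edge would join the two
clusters inside `Λ(m)`). [folklore] -/
theorem twoClusterEvt_subset_disjointOccurrence (n m : ℕ) :
    twoClusterEvt n m ⊆ crossingEvt n m □ crossingEvt n m := by
  classical
  rintro ω ⟨x, hx, x', hx', y, hy, y', hy', hxy, hx'y', hxx'⟩
  rw [(isUpperSet_crossingEvt n m).mem_disjointOccurrence_iff (isUpperSet_crossingEvt n m)]
  obtain ⟨K, hKω, hK, hKinv⟩ :=
    exists_finset_witness_of_pathIn (DCT16.mem_openConnIn_iff_pathIn.1 hxy)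
  obtain ⟨L, hLω, hL, hLinv⟩ :=
    exists_finset_witness_of_pathIn (DCT16.mem_openConnIn_iff_pathIn.1 hx'y')
  refine ⟨↑K, hKω, ↑L, hLω, ?_, ⟨x, hx, y, hy, DCT16.mem_openConnIn_iff_pathIn.2 hK⟩,
    ⟨x', hx', y', hy', DCT16.mem_openConnIn_iff_pathIn.2 hL⟩⟩
  rw [Finset.disjoint_coe, Finset.disjoint_left]
  intro e heK heL
  induction e using Sym2.ind with
  | h a b =>
    have h1 := hKinv _ heK a (Sym2.mem_mk_left a b)
    have h2 := hLinv _ heL a (Sym2.mem_mk_left a b)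
    exact hxx' (DCT16.mem_openConnIn_iff_pathIn.2 (h1.trans h2.symm))

/-- **BK reduction**: `P_{p_c}(two-cluster event) ≤ P_{p_c}(single crossing)²` for every `(n, m)`. [folklore] -/
theorem real_twoClusterEvt_le_sq (n m : ℕ) :
    critBond.real (twoClusterEvt n m) ≤ critBond.real (crossingEvt n m) ^ 2 := by
  rw [sq]
  exact (measureReal_mono (twoClusterEvt_subset_disjointOccurrence n m)).trans
    (bk_finitary _ _ (isUpperSet_crossingEvt n m) (isUpperSet_crossingEvt n m)
      (isFinitary_crossingEvt n m) (isFinitary_crossingEvt n m))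


/-! ## (b) Monotonicity in the aspect: decay at exponent `α ≥ 1` passes to every `α' ≥ α`

The two-cluster event is the union over pairs `x, x' ∈ Λ(k)` of the tree's `badPair m x x'`
(`UniquenessZone.lean`), which is antitone in `m ≥ k` (first exit of the arms; `badPair_add_antitone`).
Hence the set of exponents `α ≥ 1` at which the two-cluster probability decays is an UP-SET: the
crux `U(1/6)` gives decay at every `α ≥ 7/6`, is implied by decay at any `α ∈ [1, 7/6]`, and
together with `not_…_of_exponent_le_one` the threshold exponent `α* = inf {α | decay}` satisfies
`1 ≤ α*`; the crux asserts `α* ≤ 7/6` (print, site model: `α* ≤ 42.17`, Cerf 2015 Thm 1.2). -/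

/-- The two-cluster event as a union of the tree's bad-pair events. [folklore] -/
theorem mem_twoClusterEvt_iff {k m : ℕ} {ω : BondConfig (Site 3)} :
    ω ∈ twoClusterEvt k m ↔ ∃ x ∈ box 3 k, ∃ x' ∈ box 3 k, ω ∈ badPair m x x' := by
  constructor
  · rintro ⟨x, hx, x', hx', y, hy, y', hy', h1, h2, h3⟩
    exact ⟨x, hx, x', hx', ⟨⟨y, hy, h1⟩, ⟨y', hy', h2⟩⟩, h3⟩
  · rintro ⟨x, hx, x', hx', ⟨⟨y, hy, h1⟩, ⟨y', hy', h2⟩⟩, h3⟩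
    exact ⟨x, hx, x', hx', y, hy, y', hy', h1, h2, h3⟩

/-- **The two-cluster probability is antitone in the outer box** `m ≥ k`. [folklore] -/
theorem real_twoClusterEvt_antitone {k m m' : ℕ} (hkm : k ≤ m) (hmm' : m ≤ m') :
    critBond.real (twoClusterEvt k m') ≤ critBond.real (twoClusterEvt k m) := by
  refine DCT16.real_mono_of_forall_subset_edgeSet _ _ fun ω hω h => ?_
  rw [mem_twoClusterEvt_iff] at h ⊢
  obtain ⟨x, hx, x', hx', hb⟩ := h
  obtain ⟨j, rfl⟩ := Nat.exists_eq_add_of_le hkm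
  obtain ⟨i, rfl⟩ := Nat.exists_eq_add_of_le hmm'
  refine ⟨x, hx, x', hx', ?_⟩
  rw [add_assoc] at hb
  exact badPair_add_antitone hx hx' hω (Nat.le_add_right j i) hb

/-- `n ≤ ⌈n^α⌉₊` for `n ≥ 1`, `α ≥ 1`. [folklore] -/
theorem le_ceil_rpow {n : ℕ} {α : ℝ} (hn : 1 ≤ n) (hα : 1 ≤ α) : n ≤ ⌈(n : ℝ) ^ α⌉₊ := by
  have hn' : (1 : ℝ) ≤ n := by exact_mod_cast hn
  calc n = ⌈((n : ℕ) : ℝ)⌉₊ := (Nat.ceil_natCast n).symm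
    _ ≤ ⌈(n : ℝ) ^ α⌉₊ := Nat.ceil_mono (by
        calc (n : ℝ) = (n : ℝ) ^ (1 : ℝ) := (Real.rpow_one _).symm
          _ ≤ (n : ℝ) ^ α := Real.rpow_le_rpow_of_exponent_le hn' hα)

/-- **`AtExponent` is monotone in the exponent on `[1, ∞)`.** [folklore] -/
theorem atExponent_mono {α α' : ℝ} (h1 : 1 ≤ α) (hαα' : α ≤ α') (h : AtExponent α) :
    AtExponent α' := by
  refine squeeze_zero' (Eventually.of_forall fun n => measureReal_nonneg) ?_ h
  filter_upwards [eventually_ge_atTop 1] with n hn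
  have hn' : (1 : ℝ) ≤ n := by exact_mod_cast hn
  exact real_twoClusterEvt_antitone (le_ceil_rpow hn h1)
    (Nat.ceil_mono (Real.rpow_le_rpow_of_exponent_le hn' hαα'))

/-- The crux gives decay at every exponent `α ≥ 7/6`. [folklore] -/
theorem atExponent_of_nearLinearTwoClusterDecay {α : ℝ} (hα : (7 : ℝ) / 6 ≤ α)
    (h : PercShatteringRace.NearLinearTwoClusterDecay) : AtExponent α :=
  atExponent_mono (by norm_num) hα h

/-- Decay at any exponent `α ∈ [1, 7/6]` gives the crux. [folklore] -/
theorem nearLinearTwoClusterDecay_of_atExponent {α : ℝ} (h1 : 1 ≤ α) (hα : α ≤ (7 : ℝ) / 6)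
    (h : AtExponent α) : PercShatteringRace.NearLinearTwoClusterDecay :=
  atExponent_mono h1 hα h


/-! ## (a') Criticality from below is NOT load-bearing: the statement holds for every `p < p_c`

Union bound over `Λ(n)`, translation invariance and first exit (`DCT16.armEvent_of_pathIn`,
`DCT16.real_armEvent`) give `P_p(crossing of (Λ(n), Λ(m))) ≤ (2n+1)³ P_p(0 ↔ ∂Λ(m-n))`, and the
tree's PROVED sharpness (`DCT16.perc_sharpness_holds`, Menshikov / Aizenman–Barsky /
Duminil-Copin–Tassion) makes this summable below `p_c` as soon as `m ≥ 2n`.  So the two-cluster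
statement at the crux's aspect is TRUE for every `p < p_c`: a refutation must be a genuinely
critical (or supercritical-at-`p_c`) phenomenon. (Above `p_c` it is also expected true, by
uniqueness in slabs; not formalised.) -/

/-- First exit: a crossing of `(Λ(n), Λ(m))` from `x ∈ Λ(n)` contains an arm of length `m - n`
at `x`. [folklore] -/
theorem exists_armEvent_of_crossingEvt {n m : ℕ} (hnm : n ≤ m) {ω : BondConfig (Site 3)}
    (hω : ω ⊆ (zdGraph 3).edgeSet) (h : ω ∈ crossingEvt n m) :
    ∃ x ∈ box 3 n, ω ∈ DCT16.armEvent x (m - n) := by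
  obtain ⟨x, hx, y, hy, hxy⟩ := h
  refine ⟨x, hx, DCT16.armEvent_of_pathIn hω (DCT16.mem_openConnIn_iff_pathIn.1 hxy) ?_⟩
  by_cases hbox : y - x ∈ box 3 (m - n)
  · right
    rw [mem_innerBoundary_iff]
    refine ⟨hbox, ?_⟩
    obtain ⟨hym, z, hz, hadj⟩ := mem_innerBoundary_iff.1 hy
    rw [mem_box] at hym hbox hx
    have hz' : ∃ j, ¬(-((m : ℕ) : ℤ) ≤ z j ∧ z j ≤ m) := by
      by_contra hcon
      push Not at hcon
      exact hz (mem_box.2 hcon)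
    obtain ⟨j, hj⟩ := hz'
    have hyj := hym j
    have hxj := hx j
    have hbj := hbox j
    simp only [Pi.sub_apply] at hbj
    rw [zdGraph_adj_iff] at hadj
    obtain ⟨i, hi⟩ := hadj
    by_cases hji : j = i
    · subst hji
      rcases hi with hi | hi
      · have hzj : z j = y j + 1 := by rw [hi]; simp
        refine ⟨y - x + Pi.single j 1, ?_, ?_⟩
        · rw [mem_box]; intro hcon
          have := hcon j
          simp only [Pi.add_apply, Pi.sub_apply, Pi.single_eq_same] at this
          omega
        · rw [zdGraph_adj_iff]; exact ⟨j, Or.inl rfl⟩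
      · have hzj : y j = z j + 1 := by rw [hi]; simp
        refine ⟨y - x - Pi.single j 1, ?_, ?_⟩
        · rw [mem_box]; intro hcon
          have := hcon j
          simp only [Pi.sub_apply, Pi.single_eq_same] at this
          omega
        · rw [zdGraph_adj_iff]; exact ⟨j, Or.inr (by simp)⟩
    · exfalso
      rcases hi with hi | hi
      · have hzj : z j = y j := by rw [hi]; simp [hji]
        omega
      · have hzj : y j = z j := by rw [hi]; simp [hji]
        omega
  · exact Or.inl hbox

/-- **Union bound + translation invariance**:
`P_p(crossing of (Λ(n), Λ(m))) ≤ (2n+1)³ · P_p(0 ↔ ∂Λ(m - n))`, every `p`, `n ≤ m`. [folklore] -/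
theorem real_crossingEvt_le (p : unitInterval) {n m : ℕ} (hnm : n ≤ m) :
    (bondPercolation (zdGraph 3) p).real (crossingEvt n m) ≤
      (2 * n + 1) ^ 3 * (bondPercolation (zdGraph 3) p).real (siteToBoundary 3 (m - n)) := by
  classical
  calc (bondPercolation (zdGraph 3) p).real (crossingEvt n m)
      ≤ (bondPercolation (zdGraph 3) p).real (⋃ x ∈ box 3 n, DCT16.armEvent x (m - n)) :=
        DCT16.real_mono_of_forall_subset_edgeSet _ _ fun ω hω h => by
          obtain ⟨x, hx, hxarm⟩ := exists_armEvent_of_crossingEvt hnm hω h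
          exact Set.mem_biUnion hx hxarm
    _ ≤ ∑ x ∈ box 3 n, (bondPercolation (zdGraph 3) p).real (DCT16.armEvent x (m - n)) :=
        measureReal_biUnion_finset_le _ _
    _ = ∑ x ∈ box 3 n, (bondPercolation (zdGraph 3) p).real (siteToBoundary 3 (m - n)) :=
        Finset.sum_congr rfl fun x _ => DCT16.real_armEvent p x _
    _ = (2 * n + 1) ^ 3 * (bondPercolation (zdGraph 3) p).real (siteToBoundary 3 (m - n)) := by
        rw [Finset.sum_const, card_box, nsmul_eq_mul]; push_cast; ring

/-- **Subcritical crossing decay** (sharpness): for `p < p_c(ℤ³)` and any outer scale with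
`m n ≥ 2n` eventually, `P_p(crossing of (Λ(n), Λ(m n))) → 0`. [folklore] -/
theorem subcritical_crossing_decay (p : unitInterval)
    (hp : (p : ℝ) < criticalProb (zdGraph 3) (0 : Site 3)) {m : ℕ → ℕ}
    (hm : ∀ᶠ n in atTop, 2 * n ≤ m n) :
    Tendsto (fun n : ℕ => (bondPercolation (zdGraph 3) p).real (crossingEvt n (m n))) atTop (𝓝 0) := by
  obtain ⟨c, hc, hdecay⟩ := DCT16.perc_sharpness_holds (d := 3) (by norm_num) p hp
  have h1 : Tendsto (fun x : ℝ => x ^ 3 / Real.exp (c * x)) atTop (𝓝 0) :=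
    (isLittleO_pow_exp_pos_mul_atTop 3 hc).tendsto_div_nhds_zero
  have h2 : Tendsto (fun n : ℕ => (27 : ℝ) * ((n : ℝ) ^ 3 / Real.exp (c * n))) atTop (𝓝 0) := by
    simpa using (h1.comp tendsto_natCast_atTop_atTop).const_mul (27 : ℝ)
  refine squeeze_zero' (Eventually.of_forall fun n => measureReal_nonneg) ?_ h2
  filter_upwards [hm, eventually_ge_atTop 1] with n hmn hn1
  have hnm : n ≤ m n := by omega
  have hk : n ≤ m n - n := by omega
  have hn1' : (1 : ℝ) ≤ n := by exact_mod_cast hn1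
  calc (bondPercolation (zdGraph 3) p).real (crossingEvt n (m n))
      ≤ (2 * n + 1) ^ 3 * (bondPercolation (zdGraph 3) p).real (siteToBoundary 3 (m n - n)) :=
        real_crossingEvt_le p hnm
    _ ≤ (2 * n + 1) ^ 3 * Real.exp (-c * ↑(m n - n)) :=
        mul_le_mul_of_nonneg_left (hdecay _) (by positivity)
    _ ≤ (3 * n) ^ 3 * Real.exp (-c * n) := by
        apply mul_le_mul _ _ (by positivity) (by positivity)
        · exact pow_le_pow_left₀ (by positivity) (by linarith) 3
        · exact Real.exp_le_exp.2 (by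
            have : (n : ℝ) ≤ ((m n - n : ℕ) : ℝ) := by exact_mod_cast hk
            nlinarith)
    _ = 27 * ((n : ℝ) ^ 3 / Real.exp (c * n)) := by
        rw [neg_mul, Real.exp_neg, div_eq_mul_inv]; ring

/-- **The crux statement is TRUE strictly below `p_c`** (so criticality-from-below is not what
makes it hard): for every `p < p_c(ℤ³)`, the two-cluster probability of `(Λ(n), Λ(⌈n^{7/6}⌉))`
under `P_p` tends to `0`. [folklore] -/
theorem subcritical_twoCluster_decay (p : unitInterval)
    (hp : (p : ℝ) < criticalProb (zdGraph 3) (0 : Site 3)) :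
    Tendsto (fun n : ℕ => (bondPercolation (zdGraph 3) p).real
      (twoClusterEvt n ⌈(n : ℝ) ^ ((7 : ℝ) / 6)⌉₊)) atTop (𝓝 0) := by
  have hm : ∀ᶠ n : ℕ in atTop, 2 * n ≤ ⌈(n : ℝ) ^ ((7 : ℝ) / 6)⌉₊ := by
    filter_upwards [eventually_ge_atTop 64] with n hn
    have hn' : (64 : ℝ) ≤ n := by exact_mod_cast hn
    have h2 : (2 : ℝ) = ((2 : ℝ) ^ (6 : ℕ)) ^ ((1 : ℝ) / 6) := by
      rw [show (1 : ℝ) / 6 = ((6 : ℕ) : ℝ)⁻¹ by norm_num,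
        Real.pow_rpow_inv_natCast (by norm_num) (by norm_num)]
    have h64 : (2 : ℝ) ≤ (n : ℝ) ^ ((1 : ℝ) / 6) := by
      rw [h2]
      exact Real.rpow_le_rpow (by norm_num) (by norm_num; exact_mod_cast hn) (by norm_num)
    have key : (2 * n : ℝ) ≤ (n : ℝ) ^ ((7 : ℝ) / 6) := by
      calc (2 * n : ℝ) = 2 * (n : ℝ) ^ (1 : ℝ) := by rw [Real.rpow_one]
        _ ≤ (n : ℝ) ^ ((1 : ℝ) / 6) * (n : ℝ) ^ (1 : ℝ) := by gcongr
        _ = (n : ℝ) ^ ((7 : ℝ) / 6) := by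
            rw [← Real.rpow_add (by positivity)]; norm_num
    have : ((2 * n : ℕ) : ℝ) ≤ (⌈(n : ℝ) ^ ((7 : ℝ) / 6)⌉₊ : ℝ) := by
      push_cast; exact key.trans (Nat.le_ceil _)
    exact_mod_cast this
  refine squeeze_zero' (Eventually.of_forall fun n => measureReal_nonneg)
    (Eventually.of_forall fun n => measureReal_mono (twoClusterEvt_subset_crossingEvt _ _))
    (subcritical_crossing_decay p hp hm)


/-! ## (e) Near-miss / print boundary (sorried — documentation only, never to be landed as is) -/

/-- **Print boundary** (van den Berg–van Engelenburg, arXiv:2009.13337, Prop. 2, as transcribed in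
the route file and the grounder/refuter notes of items 0859/5785; pages NOT re-read this session —
literature services were down): at every BOUNDED multiplicative aspect `M ≥ 2` the two-cluster event
of `(Λ(n), Λ(Mn))` keeps probability `≥ δ(3, M) > 0` along a scale sequence `n_i → ∞`, hence the
probability does not tend to `0` at `m = M n`.  This is the true boundary between
`not_tendsto_additive_aspect` (PROVED above, `m = n + k`) and the crux (`m = ⌈n^{7/6}⌉`).
NOT formalised here: the printed proof is a multiscale pigeonhole over `≍ log M` scales with the
vdBvE arm-separation machinery, none of which is in the tree for `d = 3`; and since `δ(d, M)`
degrades with `M`, nothing follows from it at `M = n^{1/6}` — it neither proves nor refutes the crux.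
[folklore] -/
theorem not_tendsto_bounded_multiplicative_aspect (M : ℕ) (_hM : 2 ≤ M) :
    ¬ Tendsto (fun n : ℕ => critBond.real (twoClusterEvt n (M * n))) atTop (𝓝 0) := by
  sorry

end

end Summit.CriticalPhenomena.PercolationContinuityZ3.Cruxes.NearLinearTwoClusterDecay.Disproof
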